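import Mathlib.Algebra.Order.Field.Basic
import Mathlib.Algebra.Order.AbsoluteValue.Basic
import Mathlib.Tactic.Linarith
import Mathlib.Tactic.Positivity
import Mathlib.Tactic.FieldSimp
import Mathlib.Tactic.Ring
import HarnessLib

/-!
# Running (a-posteriori) rounding-error bounds for an arithmetic expression, under the standard model
# (Higham §3.3 «Running error analysis»; Zahradnický–Lórencz 2010, Assumption 4 and Table 1) — the
# RIGOROUS recursion (no neglected products), PROVED

Companion of `Gamma.lean` / `Summation.lean` / `Horner.lean` (same namespace, same MODEL form: the rounding
errors are hypotheses, exactly as in the sources, to be discharged per format elsewhere; no hardware,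
format or timing claim).  `Horner.lean` lists «Higham's running (a posteriori) error bound for Horner (his
Algorithm 5.1)» as NOT typed; this file types the running bound for a general tree of `+ − × ÷`
operations, which contains Horner's rule and the rational expressions a numerical integrand evaluator
meets.

THE PRINTED STATEMENTS (held text: T. Zahradnický, R. Lórencz, *FPU-Supported Running Error Analysis*,
Acta Polytechnica 50 (2010), doi:10.14311/1167 — `lit` key `paper:galaxy-pdf-6395462842311610640`,
chunk:line locators; its refs [5] = Higham, *Accuracy and Stability of Numerical Algorithms*, 2nd ed.,
SIAM 2002 (the standard model, §3.3 «Running error analysis», §5.1 Algorithm 5.1), [6]/[7] = Wilkinson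
1985/1986 (running error analysis) [p0096:L7–L9]; Higham's book itself is not held by the store — its
section numbers are cited as the method's canonical reference, the WORDING below is Zahradnický–Lórencz's):
* [p0001:L21] «Running error analysis [6, 7] is a type of a-posteriori forward error analysis. The
  algorithm being analyzed is extended to calculate the partial error bound alongside the normal
  calculation. As the algorithm proceeds, bounds are accumulated, making a total error bound estimate.»
* Assumption 4 [p0002:L18] «(Standard model) We assume that operations ◊ ∈ {+, −, ·, /} and the square
  root follow the Standard model [5] and are evaluated with error no greater than u:
  ŝ_◊ = fl(â ◊ b̂) = (â ◊ b̂)/(1 + δ_◊), |δ_◊| ≤ u … The Standard model will also be used in the form of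
  ŝ_◊ = fl(â ◊ b̂) = (â ◊ b̂)·(1 + δ_◊), where useful.»
* [p0002:L18–L20] «Table 1 summarizes the error bounds for basic operations and the square root with
  products of errors being neglected. We also assume that the following holds: ŝ = s/(1+δ_s) = s + σ,
  â = a/(1+δ_a) = a + α, and b̂ = b/(1+δ_b) = b + β, where α, β, and σ stand for absolute (static)
  errors.»  Table 1 [p0003:L1–L6]: «Addition and subtraction: σ_± ≤ u|â ± b̂| + α + β · Multiplication:
  σ_· ≤ u|âb̂| + α|b̂| + β|â| · Division: σ_/ ≤ u|â/b̂| + (α|b̂| + β|â|)/b̂² · Square root: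
  σ_√ ≤ u|√â| + α/(2|√â|)»; [p0003:L8] «The right-hand side of each error bound in Tab. 1 contains an
  error generating term u|·|, while the rest of each expression simply propagates input error(s) to the
  output.»

WHAT IS TYPED AND PROVED (namespace `Literature.ComputerArithmetic.Higham2002.RunningError`; ordered field
`K` arbitrary — `ℚ` for exact replay tables, `ℝ` for the textbook reading):
* `Expr ι τ K` — a tree of `+ − × ÷` nodes over input slots `i : ι` (data `x i`, computed `x̂ i` with
  `|x̂ i − x i| ≤ e i`) and exactly represented constants; every operation node carries a tag `t : τ` and is
  rounded by `fl t : K → K` (so MIXED precision — some nodes in a wider format — is covered by the tag).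
* `eval` (exact value `s`), `evalFl` (computed value `ŝ`: the same tree with `fl t` applied at every
  operation node), and the RUNNING BOUND `bound`, accumulated alongside `evalFl` from computed quantities
  only:  leaf `e i`; const `0`;
  `±`: `e_a + e_b + u_t|ŝ|`;  `×`: `|â| e_b + |b̂| e_a + e_a e_b + u_t|ŝ|`;
  `÷`: `(|â| e_b + |b̂| e_a)/(|b̂|(|b̂| − e_b)) + u_t|ŝ|`  (requires `e_b < |b̂|`, predicate `DivSafe`).
  These are Table 1's rules with the ERROR-GENERATING term `u|·|` read on the COMPUTED result (the form
  `ŝ = (â ◊ b̂)/(1+δ)` of Assumption 4 gives `|ŝ − â ◊ b̂| = |δ||ŝ| ≤ u|ŝ|` exactly) and WITH the products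
  of errors the printed table neglects: `+ e_a e_b` in `×`, and `|b̂|(|b̂| − e_b)` in place of `b̂²` in `÷`.
* **`abs_evalFl_sub_eval_le`** — THE THEOREM: if every rounding satisfies the standard model in the form
  `|fl t y − y| ≤ u t · |fl t y|`, the inputs satisfy `|x̂ i − x i| ≤ e i`, and every divisor node is safe
  (`bound b < |b̂|`), then `|ŝ − s| ≤ bound` at the root (and at every node).  No term is neglected, so
  this is an inequality, not an estimate; in particular CANCELLATION in a sum is accounted for exactly
  (the bound of `â − b̂` keeps `e_a + e_b` while `|ŝ|` collapses).
* `abs_sub_le_mul_of_abs_sub_le_mul` (with `abs_sub_le_mul_abs_right`) — the two forms of the standard model: `|c − y| ≤ v|y|` with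
  `v < 1` implies `|c − y| ≤ (v/(1−v))|c|` (so a format whose rounding is known only in Higham's first
  form `fl(y) = y(1+δ)`, `|δ| ≤ v`, satisfies the hypothesis here with `u = v/(1−v)`).
* `abs_evalFl_sub_eval_le_mul_abs_eval` — the reading used by a precision SWITCH «bound ≤ θ·|ŝ| ⇒
  accept»: then `|ŝ − s| ≤ θ|ŝ|` and, for `θ < 1`, `|ŝ − s| ≤ (θ/(1−θ))|s|` (relative error with
  respect to the EXACT value), and `s ≠ 0` whenever `ŝ ≠ 0`.
* `bound_nonneg`, `eval_denominator_ne_zero` (a safe divisor is nonzero exactly, so `eval` meets no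
  division by zero — no junk value is used on safe trees).
NOT typed: the square-root row; Higham's Algorithm 5.1 economisation for Horner (halving the work by
carrying `μ_i = |x|μ_{i+1} + |ŷ_i|` and correcting at the end) — the Horner tree is an instance of `Expr`
and gets the un-economised bound; the rounding errors committed in evaluating `bound` ITSELF (in practice
the recursion is run in floating point: evaluate it with upward rounding, or inflate the result — any
`B ≥ bound` inherits the theorem by transitivity); probabilistic (`√n·u`) refinements (see
`HighamMary2020/`, `ConnollyHighamMary2021/`).

(Filed by the qed-hepp literature seat as the kernel statement behind a «running rounding-error bound»
precision switch in a numerical integrand evaluator; VALUE-FREE — an inequality over an arbitrary ordered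
field, no integrand, no format constant.)
-/

namespace Literature.ComputerArithmetic.Higham2002

namespace RunningError

/-- An arithmetic expression tree: input slots `leaf i`, exactly represented constants `const c`, and
the four operations, each operation node tagged by `t : τ` (which rounding `fl t` it uses).
[cite: ZahradnickyLorencz2010, §2 Assumption 4] -/
inductive Expr (ι τ K : Type*) : Type _
  | leaf : ι → Expr ι τ K
  | const : K → Expr ι τ K
  | add : τ → Expr ι τ K → Expr ι τ K → Expr ι τ K
  | sub : τ → Expr ι τ K → Expr ι τ K → Expr ι τ K
  | mul : τ → Expr ι τ K → Expr ι τ K → Expr ι τ K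
  | div : τ → Expr ι τ K → Expr ι τ K → Expr ι τ K

variable {ι τ K : Type*} [Field K] [LinearOrder K] [IsStrictOrderedRing K]

/-- The EXACT value `s` of an expression on the exact data `x`. [cite: ZahradnickyLorencz2010, §2 Table 1] -/
def eval (x : ι → K) : Expr ι τ K → K
  | .leaf i => x i
  | .const c => c
  | .add _ a b => eval x a + eval x b
  | .sub _ a b => eval x a - eval x b
  | .mul _ a b => eval x a * eval x b
  | .div _ a b => eval x a / eval x b

/-- The COMPUTED value `ŝ`: the same tree on the computed data `x̂`, every operation node `t` rounded by
`fl t` («ŝ_◊ = fl(â ◊ b̂)»). [cite: ZahradnickyLorencz2010, §2 Assumption 4] -/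
def evalFl (fl : τ → K → K) (xh : ι → K) : Expr ι τ K → K
  | .leaf i => xh i
  | .const c => c
  | .add t a b => fl t (evalFl fl xh a + evalFl fl xh b)
  | .sub t a b => fl t (evalFl fl xh a - evalFl fl xh b)
  | .mul t a b => fl t (evalFl fl xh a * evalFl fl xh b)
  | .div t a b => fl t (evalFl fl xh a / evalFl fl xh b)

/-- The RUNNING ERROR BOUND accumulated alongside the computation, from computed quantities only
(`u t` = unit roundoff of the rounding used at tag `t`, `e i` = error bound of input `i`):
Table 1 with the error-generating term `u|ŝ|` on the computed result and WITHOUT neglecting products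
of errors (`+ e_a e_b` for `×`; `|b̂|(|b̂| − e_b)` for `b̂²` in `÷`).
[cite: ZahradnickyLorencz2010, §2 Table 1] [cite: Higham2002ASNA, §3.3] -/
def bound (fl : τ → K → K) (u : τ → K) (xh e : ι → K) : Expr ι τ K → K
  | .leaf i => e i
  | .const _ => 0
  | .add t a b => bound fl u xh e a + bound fl u xh e b + u t * |evalFl fl xh (.add t a b)|
  | .sub t a b => bound fl u xh e a + bound fl u xh e b + u t * |evalFl fl xh (.sub t a b)|
  | .mul t a b => |evalFl fl xh a| * bound fl u xh e b + |evalFl fl xh b| * bound fl u xh e a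
      + bound fl u xh e a * bound fl u xh e b + u t * |evalFl fl xh (.mul t a b)|
  | .div t a b => (|evalFl fl xh a| * bound fl u xh e b + |evalFl fl xh b| * bound fl u xh e a)
        / (|evalFl fl xh b| * (|evalFl fl xh b| - bound fl u xh e b))
      + u t * |evalFl fl xh (.div t a b)|

/-- SAFE DIVISORS: at every division node the running bound of the divisor is smaller than the
computed divisor's magnitude, `e_b < |b̂|` (then the exact divisor cannot vanish); no condition at the
other nodes. [cite: ZahradnickyLorencz2010, §2 Table 1] -/
def DivSafe (fl : τ → K → K) (u : τ → K) (xh e : ι → K) : Expr ι τ K → Prop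
  | .leaf _ => True
  | .const _ => True
  | .add _ a b => DivSafe fl u xh e a ∧ DivSafe fl u xh e b
  | .sub _ a b => DivSafe fl u xh e a ∧ DivSafe fl u xh e b
  | .mul _ a b => DivSafe fl u xh e a ∧ DivSafe fl u xh e b
  | .div _ a b => DivSafe fl u xh e a ∧ DivSafe fl u xh e b
      ∧ bound fl u xh e b < |evalFl fl xh b|

section lemmas

variable {fl : τ → K → K} {u : τ → K} {x xh e : ι → K}

/-- RELATIVE-ERROR TRANSFER between the two sides (the algebra relating the two printed forms of the
standard model, `ŝ = s/(1+δ)` and `ŝ = s(1+δ)`): if `|c − y| ≤ v|c|` with `v < 1` then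
`|c − y| ≤ (v/(1−v))·|y|` (from `|c| ≤ |y| + |c − y| ≤ |y| + v|c|`).
[cite: ZahradnickyLorencz2010, §2 Assumption 4] -/
theorem abs_sub_le_mul_abs_right {c y v : K} (hv1 : v < 1) (h : |c - y| ≤ v * |c|) :
    |c - y| ≤ v / (1 - v) * |y| := by
  have h1v : 0 < 1 - v := by linarith
  have htri : |c| ≤ |y| + |c - y| := by
    have := abs_sub_abs_le_abs_sub c y
    linarith
  have hcy0 : 0 ≤ |c - y| := abs_nonneg _
  have hc0 : 0 ≤ |c| := abs_nonneg _
  have hy0 : 0 ≤ |y| := abs_nonneg _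
  rw [div_mul_eq_mul_div, le_div_iff₀ h1v]
  by_cases hv0 : 0 ≤ v
  · -- `(1 - v)|c| ≤ |y|`, multiplied by `v ≥ 0`
    have h1 : (1 - v) * |c| ≤ |y| := by nlinarith
    nlinarith
  · have hv : v < 0 := lt_of_not_ge hv0
    -- then `|c - y| ≤ v|c| ≤ 0` forces `c = y` and `c = 0`
    have h2 : v * |c| ≤ 0 := by nlinarith
    have h3 : |c - y| = 0 := le_antisymm (le_trans h h2) hcy0
    have h4 : |c| = 0 := by nlinarith
    have h5 : |y| = 0 := by
      have : |y| ≤ |c| + |c - y| := by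
        have := abs_sub_abs_le_abs_sub y c
        rw [abs_sub_comm] at this
        linarith
      exact le_antisymm (by linarith) hy0
    rw [h3, h5]; simp

/-- The two forms of the standard model: a rounding known in Higham's first form
`|fl(y) − y| ≤ v|y|` (`fl(y) = y(1+δ)`, `|δ| ≤ v < 1`) satisfies the computed-side form
`|fl(y) − y| ≤ (v/(1−v))·|fl(y)|` used in this file (so such a format meets the hypothesis of
`abs_evalFl_sub_eval_le` with `u = v/(1−v)`). [cite: ZahradnickyLorencz2010, §2 Assumption 4]
[cite: Higham2002ASNA, §2.2] -/
theorem abs_sub_le_mul_of_abs_sub_le_mul {c y v : K} (hv1 : v < 1) (h : |c - y| ≤ v * |y|) :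
    |c - y| ≤ v / (1 - v) * |c| := by
  rw [abs_sub_comm] at h ⊢
  exact abs_sub_le_mul_abs_right hv1 h

/-- ADDITION / SUBTRACTION step: if `|â − a| ≤ α`, `|b̂ − b| ≤ β` and `|ŝ − (â ± b̂)| ≤ w`, then
`|ŝ − (a ± b)| ≤ α + β + w`. [cite: ZahradnickyLorencz2010, §2 Table 1 (row 1)] -/
theorem abs_add_step {a b ah bh sh α β w : K} (ha : |ah - a| ≤ α) (hb : |bh - b| ≤ β)
    (hs : |sh - (ah + bh)| ≤ w) : |sh - (a + b)| ≤ α + β + w := by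
  have h1 : sh - (a + b) = (sh - (ah + bh)) + ((ah - a) + (bh - b)) := by ring
  rw [h1]
  refine le_trans (abs_add_le _ _) ?_
  have h2 := abs_add_le (ah - a) (bh - b)
  linarith

/-- Subtraction step (same bound as addition; the cancellation in `â − b̂` lowers `|ŝ|`, not `α + β`).
[cite: ZahradnickyLorencz2010, §2 Table 1 (row 1)] -/
theorem abs_sub_step {a b ah bh sh α β w : K} (ha : |ah - a| ≤ α) (hb : |bh - b| ≤ β)
    (hs : |sh - (ah - bh)| ≤ w) : |sh - (a - b)| ≤ α + β + w := by
  have h1 : sh - (a - b) = (sh - (ah - bh)) + ((ah - a) - (bh - b)) := by ring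
  rw [h1]
  refine le_trans (abs_add_le _ _) ?_
  have h2 := abs_sub (ah - a) (bh - b)
  linarith

/-- MULTIPLICATION step, with the product of errors kept:
`|âb̂ − ab| ≤ |â|β + |b̂|α + αβ` (from `âb̂ − ab = â(b̂−b) + (â−a)b̂ − (â−a)(b̂−b)`), hence
`|ŝ − ab| ≤ |â|β + |b̂|α + αβ + w`. [cite: ZahradnickyLorencz2010, §2 Table 1 (row 2)] -/
theorem abs_mul_step {a b ah bh sh α β w : K} (ha : |ah - a| ≤ α) (hb : |bh - b| ≤ β)
    (hs : |sh - ah * bh| ≤ w) : |sh - a * b| ≤ |ah| * β + |bh| * α + α * β + w := by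
  have hα : 0 ≤ α := le_trans (abs_nonneg _) ha
  have hβ : 0 ≤ β := le_trans (abs_nonneg _) hb
  have h1 : sh - a * b = (sh - ah * bh) + (ah * (bh - b) + (ah - a) * bh - (ah - a) * (bh - b)) := by
    ring
  rw [h1]
  refine le_trans (abs_add_le _ _) ?_
  have h2 : |ah * (bh - b) + (ah - a) * bh - (ah - a) * (bh - b)|
      ≤ |ah| * β + |bh| * α + α * β := by
    have t1 := abs_sub (ah * (bh - b) + (ah - a) * bh) ((ah - a) * (bh - b))
    have t2 := abs_add_le (ah * (bh - b)) ((ah - a) * bh)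
    have e1 : |ah * (bh - b)| ≤ |ah| * β := by
      rw [abs_mul]; exact mul_le_mul_of_nonneg_left hb (abs_nonneg _)
    have e2 : |(ah - a) * bh| ≤ |bh| * α := by
      rw [abs_mul, mul_comm]; exact mul_le_mul_of_nonneg_left ha (abs_nonneg _)
    have e3 : |(ah - a) * (bh - b)| ≤ α * β := by
      rw [abs_mul]; exact mul_le_mul ha hb (abs_nonneg _) hα
    linarith
  linarith

/-- DIVISION step, with the divisor's error kept in the denominator: if `β < |b̂|` then `b ≠ 0` and
`|â/b̂ − a/b| ≤ (|â|β + |b̂|α)/(|b̂|(|b̂| − β))`, hence `|ŝ − a/b| ≤ that + w`.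
[cite: ZahradnickyLorencz2010, §2 Table 1 (row 3)] -/
theorem abs_div_step {a b ah bh sh α β w : K} (ha : |ah - a| ≤ α) (hb : |bh - b| ≤ β)
    (hβ : β < |bh|) (hs : |sh - ah / bh| ≤ w) :
    |sh - a / b| ≤ (|ah| * β + |bh| * α) / (|bh| * (|bh| - β)) + w := by
  have hα : 0 ≤ α := le_trans (abs_nonneg _) ha
  have hβ0 : 0 ≤ β := le_trans (abs_nonneg _) hb
  have hbh : 0 < |bh| := lt_of_le_of_lt hβ0 hβ
  have hbh0 : bh ≠ 0 := abs_pos.mp hbh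
  -- the exact divisor is at least `|b̂| − β > 0` in magnitude
  have hbge : |bh| - β ≤ |b| := by
    have := abs_sub_abs_le_abs_sub bh b
    linarith
  have hbpos : 0 < |bh| - β := by linarith
  have hb0' : 0 < |b| := lt_of_lt_of_le hbpos hbge
  have hb0 : b ≠ 0 := abs_pos.mp hb0'
  have h1 : sh - a / b = (sh - ah / bh) + (ah / bh - a / b) := by ring
  rw [h1]
  refine le_trans (abs_add_le _ _) ?_
  have h2 : ah / bh - a / b = (ah * (b - bh) + (ah - a) * bh) / (bh * b) := by
    field_simp
    ring
  have h3 : |ah / bh - a / b| ≤ (|ah| * β + |bh| * α) / (|bh| * (|bh| - β)) := by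
    rw [h2, abs_div, abs_mul]
    have hnum : |ah * (b - bh) + (ah - a) * bh| ≤ |ah| * β + |bh| * α := by
      refine le_trans (abs_add_le _ _) ?_
      rw [abs_mul, abs_mul, abs_sub_comm b bh]
      have e1 : |ah| * |bh - b| ≤ |ah| * β := mul_le_mul_of_nonneg_left hb (abs_nonneg _)
      have e2 : |ah - a| * |bh| ≤ |bh| * α := by
        rw [mul_comm]; exact mul_le_mul_of_nonneg_left ha (abs_nonneg _)
      linarith
    have hden : |bh| * (|bh| - β) ≤ |bh| * |b| := mul_le_mul_of_nonneg_left hbge hbh.le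
    have hden0 : 0 < |bh| * (|bh| - β) := mul_pos hbh hbpos
    calc |ah * (b - bh) + (ah - a) * bh| / (|bh| * |b|)
        ≤ (|ah| * β + |bh| * α) / (|bh| * |b|) := by
          gcongr
      _ ≤ (|ah| * β + |bh| * α) / (|bh| * (|bh| - β)) := by
          apply div_le_div_of_nonneg_left _ hden0 hden
          positivity
  linarith

end lemmas

/-- **Running error analysis is an inequality (Higham §3.3; Zahradnický–Lórencz Table 1 with the
neglected products restored).**  Let every rounding obey the standard model on the computed side,
`|fl t y − y| ≤ u t · |fl t y|` (Assumption 4's form `ŝ = (â ◊ b̂)/(1+δ)`, `|δ| ≤ u`), let the inputs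
satisfy `|x̂ i − x i| ≤ e i`, and let every divisor node of `E` be safe. Then the computed value and the
running bound accumulated alongside it satisfy `|evalFl E − eval E| ≤ bound E`.
[cite: ZahradnickyLorencz2010, §2 Table 1] [cite: Higham2002ASNA, §3.3] -/
theorem abs_evalFl_sub_eval_le {fl : τ → K → K} {u : τ → K}
    (hfl : ∀ t y, |fl t y - y| ≤ u t * |fl t y|) {x xh e : ι → K} (hx : ∀ i, |xh i - x i| ≤ e i) :
    ∀ E : Expr ι τ K, DivSafe fl u xh e E →
      |evalFl fl xh E - eval x E| ≤ bound fl u xh e E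
  | .leaf i, _ => by simpa [evalFl, eval, bound] using hx i
  | .const c, _ => by simp [evalFl, eval, bound]
  | .add t a b, hs => by
      have iha := abs_evalFl_sub_eval_le hfl hx a hs.1
      have ihb := abs_evalFl_sub_eval_le hfl hx b hs.2
      simp only [evalFl, eval, bound]
      exact abs_add_step iha ihb (hfl t _)
  | .sub t a b, hs => by
      have iha := abs_evalFl_sub_eval_le hfl hx a hs.1
      have ihb := abs_evalFl_sub_eval_le hfl hx b hs.2
      simp only [evalFl, eval, bound]
      exact abs_sub_step iha ihb (hfl t _)
  | .mul t a b, hs => by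
      have iha := abs_evalFl_sub_eval_le hfl hx a hs.1
      have ihb := abs_evalFl_sub_eval_le hfl hx b hs.2
      simp only [evalFl, eval, bound]
      exact abs_mul_step iha ihb (hfl t _)
  | .div t a b, hs => by
      have iha := abs_evalFl_sub_eval_le hfl hx a hs.1
      have ihb := abs_evalFl_sub_eval_le hfl hx b hs.2.1
      simp only [evalFl, eval, bound]
      exact abs_div_step iha ihb hs.2.2 (hfl t _)

/-- The running bound of a safe tree is nonnegative (it dominates an absolute value).
[cite: ZahradnickyLorencz2010, §2 Table 1] -/
theorem bound_nonneg {fl : τ → K → K} {u : τ → K}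
    (hfl : ∀ t y, |fl t y - y| ≤ u t * |fl t y|) {x xh e : ι → K} (hx : ∀ i, |xh i - x i| ≤ e i)
    (E : Expr ι τ K) (hs : DivSafe fl u xh e E) : 0 ≤ bound fl u xh e E :=
  le_trans (abs_nonneg _) (abs_evalFl_sub_eval_le hfl hx E hs)

/-- On a safe tree the EXACT value of every divisor is nonzero: `|b| ≥ |b̂| − bound b > 0` — so
`eval` never uses the field's junk value `x / 0 = 0` at a safe division node.
[cite: ZahradnickyLorencz2010, §2 Table 1 (row 3)] -/
theorem eval_divisor_ne_zero {fl : τ → K → K} {u : τ → K}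
    (hfl : ∀ t y, |fl t y - y| ≤ u t * |fl t y|) {x xh e : ι → K} (hx : ∀ i, |xh i - x i| ≤ e i)
    (t : τ) (a b : Expr ι τ K) (hs : DivSafe fl u xh e (.div t a b)) : eval x b ≠ 0 := by
  have ihb := abs_evalFl_sub_eval_le hfl hx b hs.2.1
  have hlt := hs.2.2
  have := abs_sub_abs_le_abs_sub (evalFl fl xh b) (eval x b)
  have hpos : 0 < |eval x b| := by linarith
  exact abs_pos.mp hpos

/-- THE PRECISION-SWITCH READING. If, in addition, the running bound is at most `θ` times the computed
magnitude (`bound E ≤ θ|ŝ|` — the «accept» branch of a switch «bound > θ·|ŝ| ⇒ escalate»), then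
`|ŝ − s| ≤ θ|ŝ|`; and if `θ < 1`, the relative error with respect to the EXACT value is at most
`θ/(1−θ)`: `|ŝ − s| ≤ (θ/(1−θ))·|s|`. [cite: Higham2002ASNA, §3.3] [cite: ZahradnickyLorencz2010, §2] -/
theorem abs_evalFl_sub_eval_le_mul_abs_eval {fl : τ → K → K} {u : τ → K}
    (hfl : ∀ t y, |fl t y - y| ≤ u t * |fl t y|) {x xh e : ι → K} (hx : ∀ i, |xh i - x i| ≤ e i)
    (E : Expr ι τ K) (hs : DivSafe fl u xh e E) {θ : K} (hθ1 : θ < 1)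
    (hθ : bound fl u xh e E ≤ θ * |evalFl fl xh E|) :
    |evalFl fl xh E - eval x E| ≤ θ * |evalFl fl xh E| ∧
      |evalFl fl xh E - eval x E| ≤ θ / (1 - θ) * |eval x E| := by
  have h := le_trans (abs_evalFl_sub_eval_le hfl hx E hs) hθ
  exact ⟨h, abs_sub_le_mul_abs_right hθ1 h⟩

/-- … and in that situation a nonzero computed value certifies a nonzero exact value (the sign/zero
test of the evaluator is trustworthy on the accept branch). [cite: Higham2002ASNA, §3.3] -/
theorem eval_ne_zero_of_bound_le {fl : τ → K → K} {u : τ → K}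
    (hfl : ∀ t y, |fl t y - y| ≤ u t * |fl t y|) {x xh e : ι → K} (hx : ∀ i, |xh i - x i| ≤ e i)
    (E : Expr ι τ K) (hs : DivSafe fl u xh e E) {θ : K} (hθ1 : θ < 1)
    (hθ : bound fl u xh e E ≤ θ * |evalFl fl xh E|) (hne : evalFl fl xh E ≠ 0) :
    eval x E ≠ 0 := by
  have h := (abs_evalFl_sub_eval_le_mul_abs_eval hfl hx E hs hθ1 hθ).1
  have hpos : 0 < |evalFl fl xh E| := abs_pos.mpr hne
  have := abs_sub_abs_le_abs_sub (evalFl fl xh E) (eval x E)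
  have h2 : 0 < |eval x E| := by nlinarith
  exact abs_pos.mp h2

omit [IsStrictOrderedRing K] in
/-- THE PRINTED FIRST-ORDER TABLE IS DOMINATED: Table 1's multiplication bound `u|ŝ| + α|b̂| + β|â|`
differs from the rigorous one by exactly the neglected product `αβ ≥ 0` — so a code that implements
Table 1 verbatim under-estimates the rigorous bound by that term and no more at a `×` node.
[cite: ZahradnickyLorencz2010, §2 Table 1 (row 2)] -/
theorem bound_mul_sub_firstOrder (fl : τ → K → K) (u : τ → K) (xh e : ι → K) (t : τ)
    (a b : Expr ι τ K) :
    bound fl u xh e (.mul t a b)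
      - (u t * |evalFl fl xh (.mul t a b)| + bound fl u xh e a * |evalFl fl xh b|
          + bound fl u xh e b * |evalFl fl xh a|)
      = bound fl u xh e a * bound fl u xh e b := by
  simp only [bound]
  ring

/-! ## Relative form of the node rules («relative bounds add», made exact) — append 2026-08-25

An evaluator may carry, at product / quotient nodes, a RELATIVE bound `ρ` with respect to the computed value
(`|â − a| ≤ ρ_a|â|`) instead of an absolute one; this is the absolute rule with `e := ρ|â|`.  The first-order
folklore «relative bounds add under × and ÷, plus `u` for the rounding» becomes the exact statements below:
`ρ_× = (1+ρ_a)(1+ρ_b)(1+u) − 1` and `ρ_÷ = (ρ_a+ρ_b)(1+u)/(1−ρ_b) + u`, both with respect to the computed `|ŝ|`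
(Higham's `θ`-calculus of `Gamma.lean`, Lemma 3.1, is the a-priori version of the same bookkeeping). -/

section Relative

variable {K : Type*} [Field K] [LinearOrder K] [IsStrictOrderedRing K]

/-- The exact operation result is at most `(1+u)` times the computed one under the computed-side model:
`|y| ≤ (1+u)|c|` if `|c − y| ≤ u|c|`. [cite: ZahradnickyLorencz2010, §2 Assumption 4] -/
theorem abs_le_one_add_mul_abs {c y u : K} (h : |c - y| ≤ u * |c|) : |y| ≤ (1 + u) * |c| := by
  have := abs_sub_abs_le_abs_sub y c
  rw [abs_sub_comm] at this
  linarith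

/-- MULTIPLICATION with relative input bounds: `|â − a| ≤ ρ_a|â|`, `|b̂ − b| ≤ ρ_b|b̂|`, `|ŝ − âb̂| ≤ w` ⇒
`|ŝ − ab| ≤ (ρ_a + ρ_b + ρ_aρ_b)|âb̂| + w` (the absolute rule with `α = ρ_a|â|`, `β = ρ_b|b̂|`).
[cite: ZahradnickyLorencz2010, §2 Table 1 (row 2)] -/
theorem abs_mul_step_rel {a b ah bh sh ρa ρb w : K} (ha : |ah - a| ≤ ρa * |ah|) (hb : |bh - b| ≤ ρb * |bh|)
    (hs : |sh - ah * bh| ≤ w) : |sh - a * b| ≤ (ρa + ρb + ρa * ρb) * |ah * bh| + w := by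
  have h := abs_mul_step ha hb hs
  have e : |ah| * (ρb * |bh|) + |bh| * (ρa * |ah|) + ρa * |ah| * (ρb * |bh|)
      = (ρa + ρb + ρa * ρb) * |ah * bh| := by rw [abs_mul]; ring
  linarith

/-- … hence, with the rounding `|ŝ − âb̂| ≤ u|ŝ|` and `ρ_a, ρ_b ≥ 0`, the product node carries the RELATIVE bound
`ρ_× = (1+ρ_a)(1+ρ_b)(1+u) − 1` with respect to its computed value: `|ŝ − ab| ≤ ((1+ρ_a)(1+ρ_b)(1+u) − 1)|ŝ|`
(first order: `ρ_a + ρ_b + u`). [cite: ZahradnickyLorencz2010, §2 Table 1 (row 2)] [cite: Higham2002ASNA, Lemma 3.1] -/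
theorem abs_mul_rel {a b ah bh sh ρa ρb u : K} (hρa : 0 ≤ ρa) (hρb : 0 ≤ ρb)
    (ha : |ah - a| ≤ ρa * |ah|) (hb : |bh - b| ≤ ρb * |bh|) (hs : |sh - ah * bh| ≤ u * |sh|) :
    |sh - a * b| ≤ ((1 + ρa) * (1 + ρb) * (1 + u) - 1) * |sh| := by
  have h := abs_mul_step_rel ha hb hs
  have hy : |ah * bh| ≤ (1 + u) * |sh| := abs_le_one_add_mul_abs hs
  have hc : 0 ≤ ρa + ρb + ρa * ρb := by positivity
  have h2 : (ρa + ρb + ρa * ρb) * |ah * bh| ≤ (ρa + ρb + ρa * ρb) * ((1 + u) * |sh|) :=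
    mul_le_mul_of_nonneg_left hy hc
  have e : (ρa + ρb + ρa * ρb) * ((1 + u) * |sh|) + u * |sh| = ((1 + ρa) * (1 + ρb) * (1 + u) - 1) * |sh| := by
    ring
  linarith

/-- DIVISION with relative input bounds: `|â − a| ≤ ρ_a|â|`, `|b̂ − b| ≤ ρ_b|b̂|` with `ρ_b < 1` and `b̂ ≠ 0`,
`|ŝ − â/b̂| ≤ w` ⇒ `|ŝ − a/b| ≤ ((ρ_a + ρ_b)/(1 − ρ_b))·|â/b̂| + w` (the absolute rule with `β = ρ_b|b̂| < |b̂|`).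
[cite: ZahradnickyLorencz2010, §2 Table 1 (row 3)] -/
theorem abs_div_step_rel {a b ah bh sh ρa ρb w : K} (ha : |ah - a| ≤ ρa * |ah|) (hb : |bh - b| ≤ ρb * |bh|)
    (hρb : ρb < 1) (hbh : bh ≠ 0) (hs : |sh - ah / bh| ≤ w) :
    |sh - a / b| ≤ (ρa + ρb) / (1 - ρb) * |ah / bh| + w := by
  have hbpos : 0 < |bh| := abs_pos.mpr hbh
  have hβ : ρb * |bh| < |bh| := by nlinarith
  have h := abs_div_step ha hb hβ hs
  have h1 : 0 < 1 - ρb := by linarith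
  have e : (|ah| * (ρb * |bh|) + |bh| * (ρa * |ah|)) / (|bh| * (|bh| - ρb * |bh|))
      = (ρa + ρb) / (1 - ρb) * |ah / bh| := by
    rw [abs_div]
    field_simp
    ring
  linarith

/-- … hence, with `|ŝ − â/b̂| ≤ u|ŝ|`, `ρ_a, ρ_b ≥ 0`, `ρ_b < 1`, `b̂ ≠ 0`, the quotient node carries the RELATIVE bound
`ρ_÷ = (ρ_a + ρ_b)(1+u)/(1 − ρ_b) + u` with respect to its computed value (first order: `ρ_a + ρ_b + u`).
[cite: ZahradnickyLorencz2010, §2 Table 1 (row 3)] [cite: Higham2002ASNA, Lemma 3.1] -/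
theorem abs_div_rel {a b ah bh sh ρa ρb u : K} (hρa : 0 ≤ ρa) (hρb : 0 ≤ ρb) (hρb1 : ρb < 1)
    (hbh : bh ≠ 0) (ha : |ah - a| ≤ ρa * |ah|) (hb : |bh - b| ≤ ρb * |bh|) (hs : |sh - ah / bh| ≤ u * |sh|) :
    |sh - a / b| ≤ ((ρa + ρb) * (1 + u) / (1 - ρb) + u) * |sh| := by
  have h := abs_div_step_rel ha hb hρb1 hbh hs
  have hy : |ah / bh| ≤ (1 + u) * |sh| := abs_le_one_add_mul_abs hs
  have h1 : 0 < 1 - ρb := by linarith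
  have hc : 0 ≤ (ρa + ρb) / (1 - ρb) := div_nonneg (by positivity) h1.le
  have h2 : (ρa + ρb) / (1 - ρb) * |ah / bh| ≤ (ρa + ρb) / (1 - ρb) * ((1 + u) * |sh|) :=
    mul_le_mul_of_nonneg_left hy hc
  have e : (ρa + ρb) / (1 - ρb) * ((1 + u) * |sh|) + u * |sh| = ((ρa + ρb) * (1 + u) / (1 - ρb) + u) * |sh| := by
    field_simp
  linarith

/-- ADDITION / SUBTRACTION turn relative input bounds into an ABSOLUTE bound (the place where cancellation is
paid for): `|ŝ − (a ± b)| ≤ ρ_a|â| + ρ_b|b̂| + u|ŝ|` — relative to `|ŝ|` this is `(ρ_a|â| + ρ_b|b̂|)/|ŝ| + u`,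
unbounded as `|ŝ| = |fl(â ± b̂)| → 0`. [cite: ZahradnickyLorencz2010, §2 Table 1 (row 1)] -/
theorem abs_add_step_rel {a b ah bh sh ρa ρb u : K} (ha : |ah - a| ≤ ρa * |ah|) (hb : |bh - b| ≤ ρb * |bh|)
    (hs : |sh - (ah + bh)| ≤ u * |sh|) : |sh - (a + b)| ≤ ρa * |ah| + ρb * |bh| + u * |sh| :=
  abs_add_step ha hb hs

/-- Subtraction, relative inputs (same bound as addition). [cite: ZahradnickyLorencz2010, §2 Table 1 (row 1)] -/
theorem abs_sub_step_rel {a b ah bh sh ρa ρb u : K} (ha : |ah - a| ≤ ρa * |ah|) (hb : |bh - b| ≤ ρb * |bh|)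
    (hs : |sh - (ah - bh)| ≤ u * |sh|) : |sh - (a - b)| ≤ ρa * |ah| + ρb * |bh| + u * |sh| :=
  abs_sub_step ha hb hs

end Relative

/-! ## Certificate form: ANY per-node bound obeying the node inequalities dominates the error — append 2026-08-25

In a code the running bound is itself computed in finite precision (typically rounded upward, or inflated).  What
such a code produces is not the exact function `bound` but some annotation `B` of the nodes with `B ≥` (the node rule
applied to the children's `B` and the computed magnitudes).  That is all the theorem needs: the step lemmas are
monotone in the incoming bounds.  (The annotation is a function of the subtree, as it is for any deterministic
evaluator.) -/

section Certificate

variable {ι τ K : Type*} [Field K] [LinearOrder K] [IsStrictOrderedRing K]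

/-- `B` is a RUNNING-ERROR CERTIFICATE for the tree `E` (data `x̂`, input bounds `e`, unit roundoffs `u`): at every
node of `E`, `B` is at least the node rule evaluated on the children's `B`-values and the computed magnitudes, and at
every divisor node `B b < |b̂|`.  Equality (`B = bound`) is the exact recursion; a code that rounds each rule UPWARD
produces such a `B`. [cite: ZahradnickyLorencz2010, §2 Table 1] [cite: Higham2002ASNA, §3.3] -/
def IsCert (fl : τ → K → K) (u : τ → K) (xh e : ι → K) (B : Expr ι τ K → K) : Expr ι τ K → Prop
  | .leaf i => e i ≤ B (.leaf i)
  | .const c => 0 ≤ B (.const c)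
  | .add t a b => IsCert fl u xh e B a ∧ IsCert fl u xh e B b ∧
      B a + B b + u t * |evalFl fl xh (.add t a b)| ≤ B (.add t a b)
  | .sub t a b => IsCert fl u xh e B a ∧ IsCert fl u xh e B b ∧
      B a + B b + u t * |evalFl fl xh (.sub t a b)| ≤ B (.sub t a b)
  | .mul t a b => IsCert fl u xh e B a ∧ IsCert fl u xh e B b ∧
      |evalFl fl xh a| * B b + |evalFl fl xh b| * B a + B a * B b + u t * |evalFl fl xh (.mul t a b)|
        ≤ B (.mul t a b)
  | .div t a b => IsCert fl u xh e B a ∧ IsCert fl u xh e B b ∧ B b < |evalFl fl xh b| ∧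
      (|evalFl fl xh a| * B b + |evalFl fl xh b| * B a) / (|evalFl fl xh b| * (|evalFl fl xh b| - B b))
        + u t * |evalFl fl xh (.div t a b)| ≤ B (.div t a b)

/-- **Certificate theorem**: under the standard model (computed side) and the input bounds, every running-error
certificate dominates the error: `IsCert B E → |evalFl E − eval E| ≤ B E`.  (So the finite-precision evaluation of
the running bound is covered as soon as each node rule is rounded upward.)
[cite: ZahradnickyLorencz2010, §2 Table 1] [cite: Higham2002ASNA, §3.3] -/
theorem abs_evalFl_sub_eval_le_of_isCert {fl : τ → K → K} {u : τ → K}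
    (hfl : ∀ t y, |fl t y - y| ≤ u t * |fl t y|) {x xh e : ι → K} (hx : ∀ i, |xh i - x i| ≤ e i)
    {B : Expr ι τ K → K} :
    ∀ E : Expr ι τ K, IsCert fl u xh e B E → |evalFl fl xh E - eval x E| ≤ B E
  | .leaf i, hc => by
      have h : |xh i - x i| ≤ e i := hx i
      simp only [evalFl, eval]
      exact le_trans h hc
  | .const c, hc => by
      have h0 : (0 : K) ≤ B (.const c) := hc
      simpa [evalFl, eval] using h0
  | .add t a b, hc => by
      obtain ⟨hca, hcb, hr⟩ := hc
      have iha := abs_evalFl_sub_eval_le_of_isCert hfl hx a hca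
      have ihb := abs_evalFl_sub_eval_le_of_isCert hfl hx b hcb
      simp only [evalFl, eval] at hr ⊢
      exact le_trans (abs_add_step iha ihb (hfl t _)) hr
  | .sub t a b, hc => by
      obtain ⟨hca, hcb, hr⟩ := hc
      have iha := abs_evalFl_sub_eval_le_of_isCert hfl hx a hca
      have ihb := abs_evalFl_sub_eval_le_of_isCert hfl hx b hcb
      simp only [evalFl, eval] at hr ⊢
      exact le_trans (abs_sub_step iha ihb (hfl t _)) hr
  | .mul t a b, hc => by
      obtain ⟨hca, hcb, hr⟩ := hc
      have iha := abs_evalFl_sub_eval_le_of_isCert hfl hx a hca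
      have ihb := abs_evalFl_sub_eval_le_of_isCert hfl hx b hcb
      simp only [evalFl, eval] at hr ⊢
      exact le_trans (abs_mul_step iha ihb (hfl t _)) hr
  | .div t a b, hc => by
      obtain ⟨hca, hcb, hsafe, hr⟩ := hc
      have iha := abs_evalFl_sub_eval_le_of_isCert hfl hx a hca
      have ihb := abs_evalFl_sub_eval_le_of_isCert hfl hx b hcb
      simp only [evalFl, eval] at hr ⊢
      exact le_trans (abs_div_step iha ihb hsafe (hfl t _)) hr

omit [IsStrictOrderedRing K] in
/-- The exact recursion is a certificate: on a safe tree `bound` satisfies `IsCert` (with equality at every node).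
[cite: ZahradnickyLorencz2010, §2 Table 1] -/
theorem isCert_bound (fl : τ → K → K) (u : τ → K) (xh e : ι → K) :
    ∀ E : Expr ι τ K, DivSafe fl u xh e E → IsCert fl u xh e (bound fl u xh e) E
  | .leaf i, _ => by simp [IsCert, bound]
  | .const c, _ => by simp [IsCert, bound]
  | .add t a b, hs => ⟨isCert_bound fl u xh e a hs.1, isCert_bound fl u xh e b hs.2, by simp [bound]⟩
  | .sub t a b, hs => ⟨isCert_bound fl u xh e a hs.1, isCert_bound fl u xh e b hs.2, by simp [bound]⟩
  | .mul t a b, hs => ⟨isCert_bound fl u xh e a hs.1, isCert_bound fl u xh e b hs.2, by simp [bound]⟩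
  | .div t a b, hs =>
      ⟨isCert_bound fl u xh e a hs.1, isCert_bound fl u xh e b hs.2.1, hs.2.2, by simp [bound]⟩

end Certificate

end RunningError

end Literature.ComputerArithmetic.Higham2002
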